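import Mathlib

/-!
# FunctionalMining — E2R LEMMA A kernel shadow (census-1, filed by the prove seat gen 11)

E2RLemmaA.STAGING.lean — census-1 (cell pub-nsfunc) kernel shadow of
`pub-nsfunc-census-1/exact/e2r-A/E2R-LEMMA-A.md` §2.3 (c1)–(c3) and the two calculus facts of §2.1.
search for candidate a priori estimates; no regularity claim.
Staged by census-1 (Mathlib imports only, no sorry); filed by the prove seat (gen 11) verbatim up to the
namespace `Summit.NavierStokesRegularity.FunctionalMining.E2RLemmaA`. No K0 row; nothing about regularity.

Dictionary to the markdown: the production of the trigonometric entropy Φⁿ (GMPS Def. 1.7) across a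
crease with traces e^{iψ±}, bisector β = (ψ₊+ψ₋)/2, half-opening a = Δ/2, is −2 e^{inβ} · g n a with
  g n a = (n+1) sin((n−1)a) − (n−1) sin((n+1)a),   ‖μ_n‖_∞ = 2(n²−1),   ‖μ_n′‖_∞ = 2n(n²−1).
(c1) |g n a| ≤ (2/3) n (n²−1) a³  (a ≥ 0, n ≥ 1)      ⇔ cubic bound with constant exactly (1/12)‖μ_n′‖;
(c2) g (2k+1) (π/2) = 0                                  ⇔ antipodal production vanishes for odd n;
(c3) |g n a| ≤ 2(n²−1)(π/2 − a)  (a ≤ π/2, g n (π/2) = 0) ⇔ near-antipodal bound (π−|Δ|)‖μ_n‖_∞.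
-/


open Real

namespace Summit.NavierStokesRegularity.FunctionalMining.E2RLemmaA

/-- `g n a = (n+1) sin((n-1)a) - (n-1) sin((n+1)a)`. -/
noncomputable def g (n a : ℝ) : ℝ := (n + 1) * sin ((n - 1) * a) - (n - 1) * sin ((n + 1) * a)

/-- `g n 0 = 0`. -/
@[simp] theorem g_zero (n : ℝ) : g n 0 = 0 := by simp [g]

/-- T5(a): `g_n'(a) = 2 (n² − 1) sin(na) sin a`. -/
theorem hasDerivAt_g (n a : ℝ) :
    HasDerivAt (g n) (2 * (n ^ 2 - 1) * sin (n * a) * sin a) a := by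
  have l1 : HasDerivAt (fun x : ℝ => (n - 1) * x) (n - 1) a := by
    simpa using (hasDerivAt_id a).const_mul (n - 1)
  have l2 : HasDerivAt (fun x : ℝ => (n + 1) * x) (n + 1) a := by
    simpa using (hasDerivAt_id a).const_mul (n + 1)
  have h := (l1.sin.const_mul (n + 1)).sub (l2.sin.const_mul (n - 1))
  have hcos : cos ((n - 1) * a) - cos ((n + 1) * a) = 2 * sin (n * a) * sin a := by
    have e1 : (n - 1) * a = n * a - a := by ring
    have e2 : (n + 1) * a = n * a + a := by ring
    rw [e1, e2, cos_sub, cos_add]; ring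
  have h' : HasDerivAt (fun x => (n + 1) * sin ((n - 1) * x) - (n - 1) * sin ((n + 1) * x))
      (2 * (n ^ 2 - 1) * sin (n * a) * sin a) a := by
    refine h.congr_deriv ?_
    calc (n + 1) * (cos ((n - 1) * a) * (n - 1)) - (n - 1) * (cos ((n + 1) * a) * (n + 1))
        = (n ^ 2 - 1) * (cos ((n - 1) * a) - cos ((n + 1) * a)) := by ring
      _ = 2 * (n ^ 2 - 1) * sin (n * a) * sin a := by rw [hcos]; ring
  exact h'

/-- `deriv` form of T5(a). -/
theorem deriv_g (n a : ℝ) : deriv (g n) a = 2 * (n ^ 2 - 1) * sin (n * a) * sin a :=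
  (hasDerivAt_g n a).deriv

/-- T5(c): `|sin(na) sin a| ≤ n a²` for `n ≥ 0` (all real `a`). -/
theorem abs_sin_mul_sin_le {n : ℝ} (hn : 0 ≤ n) (a : ℝ) : |sin (n * a) * sin a| ≤ n * a ^ 2 := by
  rw [abs_mul]
  calc |sin (n * a)| * |sin a| ≤ |n * a| * |a| :=
        mul_le_mul (Real.abs_sin_le_abs (x := n * a)) (Real.abs_sin_le_abs (x := a))
          (abs_nonneg _) (abs_nonneg _)
    _ = n * a ^ 2 := by rw [abs_mul, abs_of_nonneg hn, mul_assoc, ← pow_two, sq_abs]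

/-- (c1), upper half: `g n a ≤ (2/3) n (n²−1) a³` for `n ≥ 1`, `a ≥ 0`. -/
theorem g_le_cubic {n : ℝ} (hn : 1 ≤ n) {a : ℝ} (ha : 0 ≤ a) :
    g n a ≤ 2 / 3 * n * (n ^ 2 - 1) * a ^ 3 := by
  have hd : ∀ x, HasDerivAt (fun x => 2 / 3 * n * (n ^ 2 - 1) * x ^ 3 - g n x)
      (2 * (n ^ 2 - 1) * (n * x ^ 2 - sin (n * x) * sin x)) x := by
    intro x
    have h0 : HasDerivAt (fun x : ℝ => x ^ 3) (3 * x ^ 2) x := by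
      simpa using hasDerivAt_pow 3 x
    refine ((h0.const_mul (2 / 3 * n * (n ^ 2 - 1))).sub (hasDerivAt_g n x)).congr_deriv ?_
    ring
  have hmono : Monotone (fun x => 2 / 3 * n * (n ^ 2 - 1) * x ^ 3 - g n x) :=
    monotone_of_deriv_nonneg (fun x => (hd x).differentiableAt) fun x => by
      rw [(hd x).deriv]
      have h2 : sin (n * x) * sin x ≤ n * x ^ 2 :=
        (le_abs_self _).trans (abs_sin_mul_sin_le (by linarith) x)
      have hn1 : 0 ≤ n ^ 2 - 1 := by nlinarith
      have h3 : 0 ≤ n * x ^ 2 - sin (n * x) * sin x := by linarith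
      have := mul_nonneg (mul_nonneg (by norm_num : (0:ℝ) ≤ 2) hn1) h3
      simpa using this
  have h := hmono ha
  simp only [g_zero] at h
  norm_num at h
  linarith

/-- (c1), lower half. -/
theorem neg_cubic_le_g {n : ℝ} (hn : 1 ≤ n) {a : ℝ} (ha : 0 ≤ a) :
    -(2 / 3 * n * (n ^ 2 - 1) * a ^ 3) ≤ g n a := by
  have hd : ∀ x, HasDerivAt (fun x => 2 / 3 * n * (n ^ 2 - 1) * x ^ 3 + g n x)
      (2 * (n ^ 2 - 1) * (n * x ^ 2 + sin (n * x) * sin x)) x := by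
    intro x
    have h0 : HasDerivAt (fun x : ℝ => x ^ 3) (3 * x ^ 2) x := by
      simpa using hasDerivAt_pow 3 x
    refine ((h0.const_mul (2 / 3 * n * (n ^ 2 - 1))).add (hasDerivAt_g n x)).congr_deriv ?_
    ring
  have hmono : Monotone (fun x => 2 / 3 * n * (n ^ 2 - 1) * x ^ 3 + g n x) :=
    monotone_of_deriv_nonneg (fun x => (hd x).differentiableAt) fun x => by
      rw [(hd x).deriv]
      have h2 : -(n * x ^ 2) ≤ sin (n * x) * sin x := by
        have := (neg_abs_le (sin (n * x) * sin x))
        have := abs_sin_mul_sin_le (n := n) (by linarith) x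
        linarith
      have hn1 : 0 ≤ n ^ 2 - 1 := by nlinarith
      have h3 : 0 ≤ n * x ^ 2 + sin (n * x) * sin x := by linarith
      have := mul_nonneg (mul_nonneg (by norm_num : (0:ℝ) ≤ 2) hn1) h3
      simpa using this
  have h := hmono ha
  simp only [g_zero] at h
  norm_num at h
  linarith

/-- (c1): the cubic bound `|g n a| ≤ (2/3) n (n²−1) a³`, i.e. `|[Φⁿ]·ν| ≤ (1/12)‖μ_n′‖_∞ |Δ|³`
with `a = |Δ|/2`, for every real `n ≥ 1` and `a ≥ 0` (no restriction `a ≤ π/2` needed). -/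
theorem abs_g_le_cubic {n : ℝ} (hn : 1 ≤ n) {a : ℝ} (ha : 0 ≤ a) :
    |g n a| ≤ 2 / 3 * n * (n ^ 2 - 1) * a ^ 3 :=
  abs_le.mpr ⟨neg_cubic_le_g hn ha, g_le_cubic hn ha⟩

/-- (c2): antipodal production vanishes for odd `n = 2k+1`. -/
theorem g_pi_div_two_of_odd (k : ℤ) : g (2 * k + 1) (π / 2) = 0 := by
  unfold g
  have e1 : (2 * (k : ℝ) + 1 - 1) * (π / 2) = (k : ℝ) * π := by ring
  have e2 : (2 * (k : ℝ) + 1 + 1) * (π / 2) = ((k + 1 : ℤ) : ℝ) * π := by push_cast; ring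
  rw [e1, e2, sin_int_mul_pi, sin_int_mul_pi]; ring

/-- (c2), control: for even `n = 2` the antipodal production does NOT vanish: `g 2 (π/2) = 4`
(evenness of Φ is what is used). -/
theorem g_two_pi_div_two : g 2 (π / 2) = 4 := by
  have h3 : sin (3 * (π / 2)) = -1 := by
    rw [show 3 * (π / 2) = π / 2 + π by ring, sin_add_pi, sin_pi_div_two]
  unfold g
  norm_num [h3]

/-- (c3): near-antipodal bound from `g n (π/2) = 0` and `|g'| ≤ 2(n²−1)`. -/
theorem abs_g_le_near_antipodal {n : ℝ} (hn : 0 ≤ n ^ 2 - 1) (h0 : g n (π / 2) = 0)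
    {a : ℝ} (ha : a ≤ π / 2) : |g n a| ≤ 2 * (n ^ 2 - 1) * (π / 2 - a) := by
  have hss : ∀ x, -1 ≤ sin (n * x) * sin x ∧ sin (n * x) * sin x ≤ 1 := fun x => by
    constructor <;>
      nlinarith [sin_le_one (n * x), neg_one_le_sin (n * x), sin_le_one x, neg_one_le_sin x]
  have hl : ∀ y, HasDerivAt (fun x : ℝ => 2 * (n ^ 2 - 1) * (π / 2 - x)) (2 * (n ^ 2 - 1) * (0 - 1)) y :=
    fun y => ((hasDerivAt_const y (π / 2)).sub (hasDerivAt_id' y)).const_mul _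
  -- s₋(x) = 2(n²−1)(π/2 − x) − g n x is antitone
  have hd1 : ∀ x, HasDerivAt (fun x => 2 * (n ^ 2 - 1) * (π / 2 - x) - g n x)
      (2 * (n ^ 2 - 1) * (-1 - sin (n * x) * sin x)) x := by
    intro x; refine ((hl x).sub (hasDerivAt_g n x)).congr_deriv ?_; ring
  have ha1 : Antitone (fun x => 2 * (n ^ 2 - 1) * (π / 2 - x) - g n x) :=
    antitone_of_deriv_nonpos (fun x => (hd1 x).differentiableAt) fun x => by
      rw [(hd1 x).deriv]
      have : -1 - sin (n * x) * sin x ≤ 0 := by linarith [(hss x).1]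
      exact mul_nonpos_of_nonneg_of_nonpos (by positivity) this
  -- s₊(x) = 2(n²−1)(π/2 − x) + g n x is antitone
  have hd2 : ∀ x, HasDerivAt (fun x => 2 * (n ^ 2 - 1) * (π / 2 - x) + g n x)
      (2 * (n ^ 2 - 1) * (-1 + sin (n * x) * sin x)) x := by
    intro x; refine ((hl x).add (hasDerivAt_g n x)).congr_deriv ?_; ring
  have ha2 : Antitone (fun x => 2 * (n ^ 2 - 1) * (π / 2 - x) + g n x) :=
    antitone_of_deriv_nonpos (fun x => (hd2 x).differentiableAt) fun x => by
      rw [(hd2 x).deriv]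
      have : -1 + sin (n * x) * sin x ≤ 0 := by linarith [(hss x).2]
      exact mul_nonpos_of_nonneg_of_nonpos (by positivity) this
  have k1 := ha1 ha
  have k2 := ha2 ha
  simp only [h0, sub_self, mul_zero, add_zero] at k1 k2
  exact abs_le.mpr ⟨by linarith, by linarith⟩

/-- (c3) for odd `n = 2k+1` (then `n² − 1 = 4k(k+1) ≥ 0` automatically). -/
theorem abs_g_le_near_antipodal_of_odd (k : ℤ) {a : ℝ} (ha : a ≤ π / 2) :
    |g (2 * k + 1) a| ≤ 2 * ((2 * k + 1) ^ 2 - 1) * (π / 2 - a) := by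
  have hk : (0 : ℤ) ≤ k * (k + 1) := by
    by_cases h : 0 ≤ k
    · exact mul_nonneg h (by omega)
    · exact mul_nonneg_of_nonpos_of_nonpos (by omega) (by omega)
  have hk' : (0 : ℝ) ≤ (k : ℝ) * ((k : ℝ) + 1) := by exact_mod_cast hk
  exact abs_g_le_near_antipodal (by nlinarith) (g_pi_div_two_of_odd k) ha

/-- T5(b): `sin a − a cos a ≤ a³/3` for `a ≥ 0` (the value of `∫₀^a s sin s ds`). -/
theorem sin_sub_mul_cos_le_cube {a : ℝ} (ha : 0 ≤ a) : sin a - a * cos a ≤ a ^ 3 / 3 := by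
  have hd : ∀ x, HasDerivAt (fun x : ℝ => x ^ 3 / 3 - (sin x - x * cos x)) (x * (x - sin x)) x := by
    intro x
    have h0 : HasDerivAt (fun x : ℝ => x ^ 3) (3 * x ^ 2) x := by simpa using hasDerivAt_pow 3 x
    have h1 := ((hasDerivAt_sin x).sub ((hasDerivAt_id' x).mul (hasDerivAt_cos x)))
    refine ((h0.div_const 3).sub h1).congr_deriv ?_
    ring
  have hmono : Monotone (fun x : ℝ => x ^ 3 / 3 - (sin x - x * cos x)) :=
    monotone_of_deriv_nonneg (fun x => (hd x).differentiableAt) fun x => by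
      rw [(hd x).deriv]
      by_cases hx : 0 ≤ x
      · exact mul_nonneg hx (by linarith [Real.sin_le hx])
      · replace hx : x < 0 := not_le.mp hx
        have : x ≤ sin x := by
          have := Real.sin_le (neg_nonneg.mpr hx.le)
          rw [sin_neg] at this; linarith
        exact mul_nonneg_of_nonpos_of_nonpos hx.le (by linarith)
  have h := hmono ha
  norm_num at h
  linarith

/-- §2.1 (5): `cos a ≤ π/2 − a` for `a ≤ π/2`. -/
theorem cos_le_pi_div_two_sub {a : ℝ} (ha : a ≤ π / 2) : cos a ≤ π / 2 - a := by
  rw [← sin_pi_div_two_sub]; exact Real.sin_le (by linarith)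

/-- §2.1: `∫₀^a s sin s ds = sin a − a cos a`. -/
theorem integral_id_mul_sin (a : ℝ) : ∫ s in (0:ℝ)..a, s * sin s = sin a - a * cos a := by
  have hd : ∀ x ∈ Set.uIcc (0:ℝ) a, HasDerivAt (fun x : ℝ => sin x - x * cos x) (x * sin x) x := by
    intro x _
    refine ((hasDerivAt_sin x).sub ((hasDerivAt_id' x).mul (hasDerivAt_cos x))).congr_deriv ?_
    ring
  have hc : IntervalIntegrable (fun x : ℝ => x * sin x) MeasureTheory.volume 0 a :=
    (continuous_id.mul continuous_sin).intervalIntegrable _ _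
  rw [intervalIntegral.integral_eq_sub_of_hasDerivAt hd hc]; simp

end Summit.NavierStokesRegularity.FunctionalMining.E2RLemmaA
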